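import Literature.Geometry.Riemannian.SingularTimeBoundedSet
import Literature.Geometry.Riemannian.PinchingCurvatureBound
import Literature.Geometry.Riemannian.SingularTimeLimitMetric
import HarnessLib

/-!
# The limit metric `ḡ` on `Ω` for a stage satisfying the a priori assumptions
# (Chen–Zhu 2006, §4, p. 24)
(topic `Geometry/Riemannian`)

A step of the surgery construction behind
`Literature.Geometry.Riemannian.chenZhu_ricciFlowWithSurgery` (B.-L. Chen, X.-P. Zhu,
J. Differential Geom. 74 (2006), arXiv:math/0504478, Thm. 1.1). For a stage of a surgical
solution — a Ricci flow of Riemannian metrics `(g, cov)` on `[0, T)` satisfying the a priori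
assumptions `ChenZhuAPriori 𝔭 g cov T t₀` (`SurgicalSolutions.lean`) — this file assembles

* `SingularTimeBoundedSet.lean` (`Ω = boundedCurvatureSet g cov T` is open, with `R ≤ K`
  uniformly on a neighbourhood of each of its points, Chen–Zhu p. 24),
* `PinchingCurvatureBound.lean` (under the pinching assumption `R ≤ K` bounds the whole
  curvature tensor by `C_𝔭(K) = 288 (Λ (K/6 + ρ) + ρ)`), and
* `SingularTimeLimitMetric.lean` (at a point of frame-bounded curvature `g_t(x)` converges to a
  positive definite form as `t ↑ T`),

into the pointwise, continuous-in-time part of Chen–Zhu's "as `t → T`, the solution `g_ij(·,t)`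
has a smooth limit `ḡ_ij(·)` on `Ω`" (§4, p. 24):

* `limitFormAt g T x X Y = lim_{t ↑ T} g_t(x)(X, Y)` (the pointwise limit, as a plain function;
  a real definition);
* `ChenZhuAPriori.exists_nhds_curvatureBoundedOn` — every `x ∈ Ω` has a neighbourhood `V` with
  `|Rm| ≤ C` on `V × [0, T)` (`CurvatureBoundedOn`), and
  `ChenZhuAPriori.exists_curvatureBoundedOn_of_isCompact` — the same on compact subsets of `Ω`
  (the hypothesis of Shi's local derivative estimates);
* `ChenZhuAPriori.tendsto_limitFormAt` / `ChenZhuAPriori.limitFormAt_pos` /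
  `ChenZhuAPriori.exists_limitMetric_of_mem` — for `x ∈ Ω`, `g_t(x) → ḡ_x = limitFormAt g T x`,
  a symmetric bilinear form with `e^{-8CT} g_0(x) ≤ ḡ_x ≤ e^{8CT} g_0(x)` on the diagonal, in
  particular positive definite ("the `g(T)` which has been added will be a metric", Topping
  2006, p. 47);
* `ChenZhuAPriori.exists_nhds_abs_metric_sub_le` — locally uniform Cauchy estimate
  `|g_t(y)(X,X) − g_s(y)(X,X)| ≤ B g_0(y)(X,X) (t − s)` on a neighbourhood of `x ∈ Ω`.

Smoothness of `ḡ` on `Ω` (Shi's estimates) is NOT proved here. No named fact is introduced.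

## References

* B.-L. Chen, X.-P. Zhu, *Ricci flow with surgery on four-manifolds with positive isotropic
  curvature*, J. Differential Geom. 74 (2006) 177–264 (arXiv:math/0504478), §4, p. 24; §5,
  p. 26. [ChenZhu2006]
* P. Topping, *Lectures on the Ricci flow*, LMS Lecture Note Series 325 (2006), §5.3, proof of
  Thm. 5.3.1 (p. 47). [Topping2006]
-/

noncomputable section

open Bundle Set Function Filter TopologicalSpace Real Module
open scoped Manifold ContDiff Topology

namespace Literature.Geometry.Riemannian

open Lorentzian Lorentzian.PseudoRiemannianMetric

universe u v w

/-! ### The pointwise limit form -/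

section LimitForm

variable {E : Type u} [NormedAddCommGroup E] [NormedSpace ℝ E] {H : Type v} [TopologicalSpace H]
  {I : ModelWithCorners ℝ E H} {M : Type w} [TopologicalSpace M] [ChartedSpace H M]
  [IsManifold I ∞ M] {n : ℕ∞ω}

/-- **The pointwise limit `ḡ_x(X, Y) = lim_{t ↑ T} g_t(x)(X, Y)`** of a family of metrics at
the time `T` (Chen–Zhu 2006, §4, p. 24, `ḡ_ij`; Topping 2006, p. 47, "`g(T)`"), as a plain
function of `(X, Y)` (the junk value of `limUnder` where the limit does not exist; on `Ω` it is a
positive definite symmetric bilinear form, below). [cite: ChenZhu2006, §4, p. 24] -/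
def limitFormAt (g : ℝ → PseudoRiemannianMetric I n E (TangentSpace I : M → Type _)) (T : ℝ)
    (x : M) (X Y : TangentSpace I x) : ℝ :=
  limUnder (𝓝[<] T) fun t ↦ (g t).val x X Y

/-- If `g_t(x)(X, Y)` has a limit `ℓ` as `t ↑ T`, then `limitFormAt g T x X Y = ℓ`. [folklore] -/
theorem limitFormAt_eq_of_tendsto {g : ℝ → PseudoRiemannianMetric I n E (TangentSpace I : M → Type _)}
    {T : ℝ} {x : M} {X Y : TangentSpace I x} {ℓ : ℝ}
    (h : Tendsto (fun t ↦ (g t).val x X Y) (𝓝[<] T) (𝓝 ℓ)) : limitFormAt g T x X Y = ℓ :=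
  h.limUnder_eq

end LimitForm

/-! ### Stages satisfying the a priori assumptions -/

section Stage

/-- Local notation: `𝔼 n` is the model Euclidean space `EuclideanSpace ℝ (Fin n)`. -/
local notation "𝔼 " n:arg => EuclideanSpace ℝ (Fin n)

/-- Local notation: smooth pseudo-Riemannian metrics on the tangent bundle of a 4-manifold `M`. -/
local notation "Metric₄ " M:arg =>
  PseudoRiemannianMetric (𝓡 4) ∞ (EuclideanSpace ℝ (Fin 4)) (TangentSpace (𝓡 4) : M → Type _)

/-- Local notation: covariant derivatives on the tangent bundle of a 4-manifold `M`. -/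
local notation "Connection₄ " M:arg =>
  CovariantDerivative (𝓡 4) (EuclideanSpace ℝ (Fin 4)) (TangentSpace (𝓡 4) : M → Type _)

variable {M : Type} [TopologicalSpace M] [T2Space M] [CompactSpace M] [ChartedSpace (𝔼 4) M]
  [IsManifold (𝓡 4) ∞ M] [MeasurableSpace M] [BorelSpace M]
  {𝔭 : ChenZhuAPrioriParams} {g : ℝ → Metric₄ M} {cov : ℝ → Connection₄ M} {T t₀ : ℝ}

/-- **Bounded curvature near every point of `Ω`, uniformly in time** (Chen–Zhu 2006, §4,
p. 24: `Ω` is "the set of all points in `M`, where curvature stays bounded as `t → T`" and it is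
open): for a stage satisfying the a priori assumptions, every `x ∈ Ω` has a neighbourhood `V`
and a constant `C` with `|Rm_t| ≤ C` on `V` (`CurvatureBoundedOn`) for all `t ∈ [0, T)` —
`R ≤ K` on `V × [0, T)` (`ChenZhuAPriori.exists_nhds_forall_scalarCurvature_le`) and the
pinching assumption (`ChenZhuAPriori.curvatureBoundedOn_setOf_scalarCurvature_le`).
[cite: ChenZhu2006, §4, p. 24] [cite: ChenZhu2006, §5, p. 26] -/
theorem ChenZhuAPriori.exists_nhds_curvatureBoundedOn (hA : ChenZhuAPriori 𝔭 g cov T t₀)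
    (hflow : IsRicciFlow g cov (Ico 0 T)) (hRiem : ∀ t ∈ Ico 0 T, (g t).IsRiemannian)
    (hT : 0 < T) (ht₀ : 0 ≤ t₀) (hη : 0 < 𝔭.η) (hρ : 0 ≤ 𝔭.ρ) (hΛ : 0 ≤ 𝔭.Λ)
    (hrpos : ∀ t ∈ Ici (0 : ℝ), 0 < 𝔭.r t) (hranti : AntitoneOn 𝔭.r (Ici 0)) {x : M}
    (hx : x ∈ boundedCurvatureSet g cov T) :
    ∃ V ∈ 𝓝 x, ∃ C : ℝ, ∀ t ∈ Ico 0 T, CurvatureBoundedOn (g t) (cov t) V C := by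
  obtain ⟨V, hV, K, hK⟩ :=
    hA.exists_nhds_forall_scalarCurvature_le hflow hRiem hT ht₀ hη hrpos hranti hx
  refine ⟨V, hV, 288 * (𝔭.Λ * (K / 6 + 𝔭.ρ) + 𝔭.ρ), fun t ht ↦ ?_⟩
  exact (hA.curvatureBoundedOn_setOf_scalarCurvature_le hflow hRiem hρ hΛ ht K).mono
    (fun y hy ↦ hK y hy t ht) le_rfl

/-- **Bounded curvature on compact subsets of `Ω`, uniformly in time** (the hypothesis of Shi's
local derivative estimates in Chen–Zhu 2006, §4, p. 24). [cite: ChenZhu2006, §4, p. 24] -/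
theorem ChenZhuAPriori.exists_curvatureBoundedOn_of_isCompact (hA : ChenZhuAPriori 𝔭 g cov T t₀)
    (hflow : IsRicciFlow g cov (Ico 0 T)) (hRiem : ∀ t ∈ Ico 0 T, (g t).IsRiemannian)
    (hT : 0 < T) (ht₀ : 0 ≤ t₀) (hη : 0 < 𝔭.η) (hρ : 0 ≤ 𝔭.ρ) (hΛ : 0 ≤ 𝔭.Λ)
    (hrpos : ∀ t ∈ Ici (0 : ℝ), 0 < 𝔭.r t) (hranti : AntitoneOn 𝔭.r (Ici 0)) {C : Set M}
    (hC : IsCompact C) (hCΩ : C ⊆ boundedCurvatureSet g cov T) :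
    ∃ K : ℝ, ∀ t ∈ Ico 0 T, CurvatureBoundedOn (g t) (cov t) C K := by
  obtain ⟨K, hK⟩ :=
    hA.exists_forall_scalarCurvature_le_of_isCompact hflow hRiem hT ht₀ hη hrpos hranti hC hCΩ
  refine ⟨288 * (𝔭.Λ * (K / 6 + 𝔭.ρ) + 𝔭.ρ), fun t ht ↦ ?_⟩
  exact (hA.curvatureBoundedOn_setOf_scalarCurvature_le hflow hRiem hρ hΛ ht K).mono
    (fun y hy ↦ hK y hy t ht) le_rfl

/-- **The frame bound at a point of `Ω` over the whole of `[0, T)`**: if `R(x, ·) ≤ K` on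
`[0, T)` then `|Rm_t(x)| ≤ 288 (Λ (K/6 + ρ) + ρ)` on unit-bounded vectors for all `t`.
[cite: ChenZhu2006, §5, p. 26] -/
theorem ChenZhuAPriori.abs_curvatureForm_le_of_forall_le (hA : ChenZhuAPriori 𝔭 g cov T t₀)
    (hflow : IsRicciFlow g cov (Ico 0 T)) (hRiem : ∀ t ∈ Ico 0 T, (g t).IsRiemannian)
    (hρ : 0 ≤ 𝔭.ρ) (hΛ : 0 ≤ 𝔭.Λ) {x : M} {K : ℝ}
    (hK : ∀ t ∈ Ico 0 T, (g t).scalarCurvatureWith (cov t) x ≤ K) :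
    ∀ t ∈ Ico 0 T, ∀ X Y Z W : TangentSpace (𝓡 4) x, (g t).val x X X ≤ 1 →
      (g t).val x Y Y ≤ 1 → (g t).val x Z Z ≤ 1 → (g t).val x W W ≤ 1 →
        |(g t).curvatureForm (cov t) x X Y Z W| ≤ 288 * (𝔭.Λ * (K / 6 + 𝔭.ρ) + 𝔭.ρ) :=
  fun t ht _ _ _ _ hX hY hZ hW ↦
    hA.abs_curvatureForm_le hflow hRiem hρ hΛ ht x (hK t ht) hX hY hZ hW

/-- **The limit metric `ḡ_x` exists at every point of `Ω`** (Chen–Zhu 2006, §4, p. 24,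
pointwise `C⁰`-in-time part; Topping 2006, p. 47): for a stage satisfying the a priori
assumptions and `x ∈ Ω` with `R(x, ·) ≤ K` on `[0, T)`, there is a symmetric bilinear form
`ḡ_x` on `T_x M` with `g_t(x)(X, Y) → ḡ_x(X, Y)` as `t ↑ T`, and with `C = 288(Λ(K/6+ρ)+ρ)`,
`e^{-8CT} g_0(x)(X,X) ≤ ḡ_x(X,X) ≤ e^{8CT} g_0(x)(X,X)`; in particular `ḡ_x` is positive
definite. [cite: ChenZhu2006, §4, p. 24] [cite: Topping2006, §5.3, proof of Thm. 5.3.1 (p. 47)] -/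
theorem ChenZhuAPriori.exists_limitMetric_of_forall_le (hA : ChenZhuAPriori 𝔭 g cov T t₀)
    (hflow : IsRicciFlow g cov (Ico 0 T)) (hRiem : ∀ t ∈ Ico 0 T, (g t).IsRiemannian)
    (hT : 0 < T) (hρ : 0 ≤ 𝔭.ρ) (hΛ : 0 ≤ 𝔭.Λ) {x : M} {K : ℝ}
    (hK : ∀ t ∈ Ico 0 T, (g t).scalarCurvatureWith (cov t) x ≤ K) :
    ∃ gT : LinearMap.BilinForm ℝ (TangentSpace (𝓡 4) x),
      (∀ X Y, Tendsto (fun t ↦ (g t).val x X Y) (𝓝[<] T) (𝓝 (gT X Y))) ∧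
      (∀ X Y, gT X Y = gT Y X) ∧
      (∀ X, exp (-(2 * (4 * (288 * (𝔭.Λ * (K / 6 + 𝔭.ρ) + 𝔭.ρ))) * T)) * (g 0).val x X X ≤
          gT X X ∧
        gT X X ≤ exp (2 * (4 * (288 * (𝔭.Λ * (K / 6 + 𝔭.ρ) + 𝔭.ρ))) * T) * (g 0).val x X X) ∧
      ∀ X, X ≠ 0 → 0 < gT X X := by
  have h0 : (0 : ℝ) ∈ Ico 0 T := ⟨le_rfl, hT⟩
  have hb := hA.abs_curvatureForm_le_of_forall_le hflow hRiem hρ hΛ hK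
  have h := hflow.exists_limitMetric_at hRiem h0 hb
  simp only [finrank_euclideanSpace_fin, Nat.cast_ofNat, sub_zero] at h
  exact h

/-- **On `Ω` the pointwise limit `limitFormAt g T x` is the limit of `g_t(x)`** and is a
positive definite symmetric bilinear form (`ChenZhuAPriori.exists_limitMetric_of_forall_le`
with the identification `limitFormAt_eq_of_tendsto`). [cite: ChenZhu2006, §4, p. 24] -/
theorem ChenZhuAPriori.exists_limitMetric_of_mem (hA : ChenZhuAPriori 𝔭 g cov T t₀)
    (hflow : IsRicciFlow g cov (Ico 0 T)) (hRiem : ∀ t ∈ Ico 0 T, (g t).IsRiemannian)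
    (hT : 0 < T) (hρ : 0 ≤ 𝔭.ρ) (hΛ : 0 ≤ 𝔭.Λ) {x : M} (hx : x ∈ boundedCurvatureSet g cov T) :
    ∃ gT : LinearMap.BilinForm ℝ (TangentSpace (𝓡 4) x),
      (∀ X Y, gT X Y = limitFormAt g T x X Y) ∧
      (∀ X Y, Tendsto (fun t ↦ (g t).val x X Y) (𝓝[<] T) (𝓝 (gT X Y))) ∧
      (∀ X Y, gT X Y = gT Y X) ∧ ∀ X, X ≠ 0 → 0 < gT X X := by
  obtain ⟨K, hK⟩ := hx
  obtain ⟨gT, hconv, hsymm, -, hpos⟩ := hA.exists_limitMetric_of_forall_le hflow hRiem hT hρ hΛ hK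
  exact ⟨gT, fun X Y ↦ (limitFormAt_eq_of_tendsto (hconv X Y)).symm, hconv, hsymm, hpos⟩

/-- **`g_t(x) → ḡ_x = limitFormAt g T x` on `Ω`** (Chen–Zhu 2006, §4, p. 24).
[cite: ChenZhu2006, §4, p. 24] -/
theorem ChenZhuAPriori.tendsto_limitFormAt (hA : ChenZhuAPriori 𝔭 g cov T t₀)
    (hflow : IsRicciFlow g cov (Ico 0 T)) (hRiem : ∀ t ∈ Ico 0 T, (g t).IsRiemannian)
    (hT : 0 < T) (hρ : 0 ≤ 𝔭.ρ) (hΛ : 0 ≤ 𝔭.Λ) {x : M} (hx : x ∈ boundedCurvatureSet g cov T)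
    (X Y : TangentSpace (𝓡 4) x) :
    Tendsto (fun t ↦ (g t).val x X Y) (𝓝[<] T) (𝓝 (limitFormAt g T x X Y)) := by
  obtain ⟨gT, hgT, hconv, -, -⟩ := hA.exists_limitMetric_of_mem hflow hRiem hT hρ hΛ hx
  rw [← hgT X Y]
  exact hconv X Y

/-- **`ḡ_x` is positive definite on `Ω`** ("the `g(T)` which has been added will be a metric.
(In particular, it will be positive definite.)", Topping 2006, p. 47; Chen–Zhu 2006, §4,
p. 24). [cite: ChenZhu2006, §4, p. 24] [cite: Topping2006, §5.3, proof of Thm. 5.3.1 (p. 47)] -/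
theorem ChenZhuAPriori.limitFormAt_pos (hA : ChenZhuAPriori 𝔭 g cov T t₀)
    (hflow : IsRicciFlow g cov (Ico 0 T)) (hRiem : ∀ t ∈ Ico 0 T, (g t).IsRiemannian)
    (hT : 0 < T) (hρ : 0 ≤ 𝔭.ρ) (hΛ : 0 ≤ 𝔭.Λ) {x : M} (hx : x ∈ boundedCurvatureSet g cov T)
    {X : TangentSpace (𝓡 4) x} (hX : X ≠ 0) : 0 < limitFormAt g T x X X := by
  obtain ⟨gT, hgT, -, -, hpos⟩ := hA.exists_limitMetric_of_mem hflow hRiem hT hρ hΛ hx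
  rw [← hgT X X]
  exact hpos X hX

/-- **`ḡ_x` is symmetric and bilinear on `Ω`**: additivity and homogeneity in the first slot,
symmetry. [cite: ChenZhu2006, §4, p. 24] -/
theorem ChenZhuAPriori.limitFormAt_symm_add_smul (hA : ChenZhuAPriori 𝔭 g cov T t₀)
    (hflow : IsRicciFlow g cov (Ico 0 T)) (hRiem : ∀ t ∈ Ico 0 T, (g t).IsRiemannian)
    (hT : 0 < T) (hρ : 0 ≤ 𝔭.ρ) (hΛ : 0 ≤ 𝔭.Λ) {x : M} (hx : x ∈ boundedCurvatureSet g cov T) :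
    (∀ X Y : TangentSpace (𝓡 4) x, limitFormAt g T x X Y = limitFormAt g T x Y X) ∧
      (∀ X X' Y : TangentSpace (𝓡 4) x,
        limitFormAt g T x (X + X') Y = limitFormAt g T x X Y + limitFormAt g T x X' Y) ∧
      ∀ (c : ℝ) (X Y : TangentSpace (𝓡 4) x),
        limitFormAt g T x (c • X) Y = c * limitFormAt g T x X Y := by
  obtain ⟨gT, hgT, -, hsymm, -⟩ := hA.exists_limitMetric_of_mem hflow hRiem hT hρ hΛ hx
  refine ⟨fun X Y ↦ ?_, fun X X' Y ↦ ?_, fun c X Y ↦ ?_⟩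
  · rw [← hgT, ← hgT, hsymm]
  · rw [← hgT, ← hgT, ← hgT, map_add, LinearMap.add_apply]
  · rw [← hgT, ← hgT, map_smul, LinearMap.smul_apply, smul_eq_mul]

/-- **Locally uniform convergence to `ḡ` on `Ω`** (the Cauchy estimate of
`IsRicciFlow.abs_metric_sub_le_at` with the neighbourhood bound of
`ChenZhuAPriori.exists_nhds_forall_scalarCurvature_le`): every `x ∈ Ω` has a neighbourhood
`V` and a constant `B` with `|g_t(y)(X,X) − g_s(y)(X,X)| ≤ B g_0(y)(X,X) (t − s)` for `y ∈ V`,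
`0 ≤ s ≤ t < T` and all `X`. [cite: ChenZhu2006, §4, p. 24] [cite: Topping2006, §5.3, proof of Thm. 5.3.1 (p. 47)] -/
theorem ChenZhuAPriori.exists_nhds_abs_metric_sub_le (hA : ChenZhuAPriori 𝔭 g cov T t₀)
    (hflow : IsRicciFlow g cov (Ico 0 T)) (hRiem : ∀ t ∈ Ico 0 T, (g t).IsRiemannian)
    (hT : 0 < T) (ht₀ : 0 ≤ t₀) (hη : 0 < 𝔭.η) (hρ : 0 ≤ 𝔭.ρ) (hΛ : 0 ≤ 𝔭.Λ)
    (hrpos : ∀ t ∈ Ici (0 : ℝ), 0 < 𝔭.r t) (hranti : AntitoneOn 𝔭.r (Ici 0)) {x : M}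
    (hx : x ∈ boundedCurvatureSet g cov T) :
    ∃ V ∈ 𝓝 x, ∃ B : ℝ, ∀ y ∈ V, ∀ (X : TangentSpace (𝓡 4) y) {s t : ℝ}, 0 ≤ s → s ≤ t → t < T →
      |(g t).val y X X - (g s).val y X X| ≤ B * (g 0).val y X X * (t - s) := by
  obtain ⟨V, hV, K, hK⟩ :=
    hA.exists_nhds_forall_scalarCurvature_le hflow hRiem hT ht₀ hη hrpos hranti hx
  set C : ℝ := 288 * (𝔭.Λ * (K / 6 + 𝔭.ρ) + 𝔭.ρ) with hC
  refine ⟨V, hV, 2 * (4 * C) * exp (2 * (4 * C) * T), fun y hy X s t hs hst ht ↦ ?_⟩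
  have h0 : (0 : ℝ) ∈ Ico 0 T := ⟨le_rfl, hT⟩
  have hb := hA.abs_curvatureForm_le_of_forall_le hflow hRiem hρ hΛ (hK y hy)
  have h := hflow.abs_metric_sub_le_at hRiem h0 hb X hs hst ht
  simp only [finrank_euclideanSpace_fin, Nat.cast_ofNat, sub_zero] at h
  calc |(g t).val y X X - (g s).val y X X|
      ≤ 2 * (4 * C) * exp (2 * (4 * C) * T) * (g 0).val y X X * (t - s) := h
    _ = 2 * (4 * C) * exp (2 * (4 * C) * T) * (g 0).val y X X * (t - s) := rfl

end Stage

end Literature.Geometry.Riemannian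

end
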